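import Summits.QuantumFields.BalabanUV.Beta.GAN24.FibreArrowBZ
import Summits.QuantumFields.BalabanUV.Beta.GAN24.Capacitance

/-!
# `BalabanUV.Beta.GAN24.EnlargedCapacitance` — binder row G-an2-4 / (CONV-C), road P1-fibre (toward p1's L10 `FibreStrip`, (U1)/(U2) of `StripRegularPackaging`):
# THE ENLARGED CAPACITANCE SYSTEM — the Bloch fibre system with every GOOD alias `m ≠ 0` eliminated and the ZERO alias KEPT AS UNKNOWNS

NOT IN PRINT; OUR PROOF ATTEMPT.  HONEST FRAMING (cell contract, verbatim): «discharging `BetaPertH` makes Bałaban's UV stability UNCONDITIONAL — a real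
constructive-QFT result; it is NOT the continuum limit and NOT the Clay problem.»  HONEST DEPENDENCY (verbatim): «continuum YM on T⁴ ⇐ BetaPertH ∧ nine spine
estimates (0/9 proved); BetaPertH ⇐ (D1) ∧ (D4) ∧ CAP+tail; G-an2-4 gates asym, D1 and NE2/3/4.»  [folklore] finite-dimensional linear algebra over `ℂ` (no estimate,
no cited fact, no wall binder, no `def … : Prop` fact — `EnlArrow`/`EnlSolves` are SHAPES asserted of nothing).  NOT summit progress; nothing of (CONV-C)'s K-slot is
discharged here.

## Why (journal STRUCTURE NOTE of this unit, 2026-08-20 ≈00:15Z)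
On a complex strip `|Im p| ≤ κ` (coarse units, `κ` `j`-uniform as (I3′) demands) every GOOD alias `m ≠ 0` keeps `L_m(p) ≠ 0` (relative perturbation `O(κ)` of
`L_m(Re p) ≥ 4/N²`), but the ZERO alias `m = 0` has `L_0(p) = Σ_κ 4 sin²(p_κ/2N)` vanishing on the complex null cone `Σ_κ p_κ² ≈ 0`, which meets every strip.  So the
closed form of Y08f/`Capacitance` (which divides by `L_0`) cannot be continued termwise, while the fibre matrix itself stays invertible.  THIS FILE keeps the zero alias's
amplitudes `(Â_0, μ̂_0)` as unknowns next to the globals `(φ, c)`: the reduced system has `2D+2` unknowns, its coefficients are the zero-alias SYMBOLS and border WEIGHTS and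
leaf-15's capacitance sums over the GOOD aliases only — NO division by `L_0`, every entry holomorphic in `p` across the cone — and it specialises to `FibreArrowBZ`'s
`p = 0` packaging (`∂̂(k_0) = 0`) and, where `L_0 ≠ 0`, to Y08f's closed form.

## What is proved (generic `D`, `N ≥ 1`, EVERY COMPLEX `p`; hypothesis only `hL′ : ∀ m ≠ 0, L_m(p) ≠ 0`)
* §1 `Good D N = {m // m ≠ 0}`, the good fibre `goodFibre p hL′ : CapacitanceSolve.Fibre D (Good D N)` (symbols/borders of `FibreArrow.aliasFibre` on `m ≠ 0`), the
  zero-alias data `ZeroAlias`/`zeroAlias p`;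
* §2 [shapes] `EnlArrow F z …` (the arrow system split at the zero alias: good EL/G rows, zero EL/G rows with general symbols, M/Q rows with the zero terms separated) and
  `EnlSolves F z …` (THE ENLARGED CAPACITANCE SYSTEM in `(A0, μ0, φ, c)`: zero EL/G rows + Q/M rows with the good aliases replaced by leaf-15's `Ablk`/`mublk`);
  **`enlArrow_iff`**: `EnlArrow … A μ A0 μ0 φ c ↔ A = Ablk F f γ φ c ∧ μ = mublk F f φ ∧ EnlSolves … A0 μ0 φ c` (leaf-15's `block_unique`/`elRows_Ablk`/`gRows_Ablk` BY NAME)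
  — for ANY fibre data `F` on any finite index and any zero data `z`;
* §3 **`fibreFun_eq_iff_enlArrow`** / **`fibreFun_eq_iff_enlSolves`**: `fibreFun (blochChar p) v = r` ⟺ the good amplitudes are `Ablk`/`mublk` of the good fibre AND
  `(ampA p v 0, ampμ p v 0, v∘inr∘inr, c)` solves the enlarged system with the sources of `r` (`FibreArrow.EL_iff/G_iff/M_iff/Q_iff`, which need NO `hL`, split by
  `FibreArrowBZ.forall_torus_iff/sum_torus_eq`);
* §4 **(U1) SOCKET** `det_fibreMatrix_ne_zero_of_enl_injective` (+ `trigPolySymbol` form): if the HOMOGENEOUS enlarged system at `p` has only the trivial solution then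
  `det (fibreMatrix (blochChar p)) ≠ 0` — so L10's (U1) on the strip is the injectivity (with N-uniform bounds: (U2)) of ONE `(2D+2)×(2D+2)` holomorphic family;
* §5 **(U2) SOCKET** `boxData_eq_of_fibreFun_eq`: the box data of the solution = zero-alias wave + explicit good-alias synthesis (`Ablk`/`mublk`) at the enlarged solution.
Unit `b2b-balaban-gan24-formalise-leaf-06` (G-an2-4 formalisation swarm), 2026-08-20.
-/

noncomputable section

open Complex Finset
open scoped BigOperators
open Literature.MathematicalPhysics.QuantumFieldTheory.Balaban1983to89
open Literature.MathematicalPhysics.QuantumFieldTheory.Balaban1983to89.Beta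
open Literature.MathematicalPhysics.QuantumFieldTheory.LatticeForm (repZ)
open Literature.Probability.LatticeModels (TorusSite)
open BlochFibreMatrix (Idx blochChar fibreFun fibreLin fibreLin_apply fibreMatrix fibreMatrix_mulVec fibreMatrix_blochChar_eq_trigPolySymbol stencil pieceMatrix)
open FibreInverseDecay (trigPolySymbol det_ne_zero_of_mulVec_injective)
open Summit.QuantumFields.BalabanUV.Beta.GAN24.FibreSymbols (dhat dflat lapSym)
open Summit.QuantumFields.BalabanUV.Beta.GAN24.FibreBlockSolve (dot)
open Summit.QuantumFields.BalabanUV.Beta.GAN24.FibreDFT (kFine)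
open Summit.QuantumFields.BalabanUV.Beta.GAN24.FibreDFTDictionary (ampA ampμ boxData_inl_eq_sum boxData_inr_eq_sum)
open Summit.QuantumFields.BalabanUV.Beta.GAN24.FibreArrow (chiHat sflat boxS boxSs srcEL srcG EL_iff G_iff M_iff Q_iff fibreFun_eq_iff_rows dot_dflat_dhat)
open Summit.QuantumFields.BalabanUV.Beta.GAN24.FibreArrowBZ (forall_torus_iff sum_torus_eq)
open Summit.QuantumFields.BalabanUV.Beta.GAN24.Capacitance (amp_zero' srcEL_zero srcG_zero)
open Summit.QuantumFields.BalabanUV.Beta.GAN24.CapacitanceSolve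
  (Fibre ELRows GRows Ablk mublk block_unique elRows_Ablk gRows_Ablk Ablk_zero mublk_zero)

namespace Summit.QuantumFields.BalabanUV.Beta.GAN24.EnlargedCapacitance

variable {D N : ℕ} [NeZero N]

/-! ## §1 Good aliases, the good fibre, the zero-alias data -/

/-- [folklore] The GOOD aliases: every `m ≠ 0`. -/
abbrev Good (D N : ℕ) [NeZero N] : Type := {m : TorusSite D N // m ≠ 0}

/-- [folklore] THE GOOD FIBRE at (complex) quasi-momentum `p`: symbols/borders of `FibreArrow.aliasFibre` restricted to `m ≠ 0` (`hL′ : L_m ≠ 0` there only). -/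
def goodFibre (p : Fin D → ℂ) (hL' : ∀ m : Good D N, lapSym (kFine p m.1) ≠ 0) : Fibre D (Good D N) where
  dd m := dhat (kFine p m.1)
  db m := dflat (kFine p m.1)
  L m := lapSym (kFine p m.1)
  wE m κ := chiHat p m.1 * sflat p m.1 κ
  wG m := chiHat p m.1
  wM m := boxS p m.1
  wQ m κ := boxSs p m.1 κ
  L_ne := hL'
  dot_db_dd m := dot_dflat_dhat (kFine p m.1)

/-- [folklore] ZERO-ALIAS DATA: symbols `∂̂(k_0)`, `∂̂♭(k_0)`, `L_0` and border weights `wE⁰, wG⁰, wM⁰, wQ⁰` (no non-degeneracy assumed — `L_0` MAY vanish). -/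
structure ZeroAlias (D : ℕ) where
  /-- `∂̂(k_0)` -/
  dd0 : Fin D → ℂ
  /-- `∂̂♭(k_0)` -/
  db0 : Fin D → ℂ
  /-- `L_0` -/
  L0 : ℂ
  /-- EL border weight of the zero alias (`χ̂_0 s♭_κ(0)`) -/
  wE0 : Fin D → ℂ
  /-- G border weight (`χ̂_0`) -/
  wG0 : ℂ
  /-- M weight (`S(0)`) -/
  wM0 : ℂ
  /-- Q weights (`S(0) s_κ(0)`) -/
  wQ0 : Fin D → ℂ

/-- [folklore] The zero-alias data of the alias lattice at `p`. -/
def zeroAlias (p : Fin D → ℂ) : ZeroAlias D where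
  dd0 := dhat (kFine p (0 : TorusSite D N))
  db0 := dflat (kFine p (0 : TorusSite D N))
  L0 := lapSym (kFine p (0 : TorusSite D N))
  wE0 κ := chiHat p (0 : TorusSite D N) * sflat p (0 : TorusSite D N) κ
  wG0 := chiHat p (0 : TorusSite D N)
  wM0 := boxS p (0 : TorusSite D N)
  wQ0 κ := boxSs p (0 : TorusSite D N) κ

/-! ## §2 The split arrow system and the enlarged capacitance system (shapes) -/

section Shapes

variable {ι : Type*} [Fintype ι] (F : Fibre D ι) (z : ZeroAlias D)

/-- [shape] THE ARROW SYSTEM SPLIT AT THE ZERO ALIAS: good EL/G rows (`ELRows`/`GRows` of `F`), zero EL/G rows with GENERAL symbols, and the M/Q rows with the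
zero terms separated.  Asserted of nothing. -/
def EnlArrow (f : ι → Fin D → ℂ) (γ : ι → ℂ) (f0 : Fin D → ℂ) (γ0 ρ : ℂ) (q : Fin D → ℂ)
    (A : ι → Fin D → ℂ) (μ : ι → ℂ) (A0 : Fin D → ℂ) (μ0 : ℂ) (φ : Fin D → ℂ) (c : ℂ) : Prop :=
  ELRows F f A μ φ ∧ GRows F γ A c ∧
    (∀ κ, 2 * (z.L0 * A0 κ - z.dd0 κ * dot z.db0 A0) - z.L0 * z.dd0 κ * μ0 - z.wE0 κ * φ κ = f0 κ) ∧
    (z.L0 * dot z.db0 A0 - z.wG0 * c = γ0) ∧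
    (z.wM0 * μ0 + ∑ m, F.wM m * μ m = ρ) ∧ (∀ κ, z.wQ0 κ * A0 κ + ∑ m, F.wQ m κ * A m κ = q κ)

/-- [shape] **THE ENLARGED CAPACITANCE SYSTEM** in the `2D+2` unknowns `(A0, μ0, φ, c)`: zero EL/G rows, and the Q/M rows with every good alias replaced by leaf-15's
explicit `Ablk`/`mublk` (affine in `(φ, c)`).  No division by `L_0`.  Asserted of nothing. -/
def EnlSolves (f : ι → Fin D → ℂ) (γ : ι → ℂ) (f0 : Fin D → ℂ) (γ0 ρ : ℂ) (q : Fin D → ℂ)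
    (A0 : Fin D → ℂ) (μ0 : ℂ) (φ : Fin D → ℂ) (c : ℂ) : Prop :=
  (∀ κ, 2 * (z.L0 * A0 κ - z.dd0 κ * dot z.db0 A0) - z.L0 * z.dd0 κ * μ0 - z.wE0 κ * φ κ = f0 κ) ∧
    (z.L0 * dot z.db0 A0 - z.wG0 * c = γ0) ∧
    (∀ κ, z.wQ0 κ * A0 κ + ∑ m, F.wQ m κ * Ablk F f γ φ c m κ = q κ) ∧
    (z.wM0 * μ0 + ∑ m, F.wM m * mublk F f φ m = ρ)

/-- [folklore] **GOOD-ALIAS ELIMINATION**: the split arrow system holds iff the good amplitudes ARE `Ablk`/`mublk` and the enlarged capacitance system holds. -/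
theorem enlArrow_iff (f : ι → Fin D → ℂ) (γ : ι → ℂ) (f0 : Fin D → ℂ) (γ0 ρ : ℂ) (q : Fin D → ℂ)
    (A : ι → Fin D → ℂ) (μ : ι → ℂ) (A0 : Fin D → ℂ) (μ0 : ℂ) (φ : Fin D → ℂ) (c : ℂ) :
    EnlArrow F z f γ f0 γ0 ρ q A μ A0 μ0 φ c ↔
      A = Ablk F f γ φ c ∧ μ = mublk F f φ ∧ EnlSolves F z f γ f0 γ0 ρ q A0 μ0 φ c := by
  constructor
  · rintro ⟨hEL, hG, hE0, hG0, hM, hQ⟩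
    have hA : A = Ablk F f γ φ c := funext fun m => (block_unique F hEL hG m).2
    have hμ : μ = mublk F f φ := funext fun m => (block_unique F hEL hG m).1
    refine ⟨hA, hμ, hE0, hG0, fun κ => ?_, ?_⟩
    · rw [← hA]; exact hQ κ
    · rw [← hμ]; exact hM
  · rintro ⟨hA, hμ, hE0, hG0, hQ, hM⟩
    subst hA; subst hμ
    exact ⟨elRows_Ablk F f γ φ c, gRows_Ablk F f γ φ c, hE0, hG0, hM, hQ⟩

end Shapes

/-! ## §3 The Bloch fibre system IS the enlarged system -/

section Dictionary

variable (p : Fin D → ℂ) (hL' : ∀ m : Good D N, lapSym (kFine p m.1) ≠ 0)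

/-- [folklore] **THE FIBRE SYSTEM SPLIT AT THE ZERO ALIAS** (every complex `p`; only `L_m ≠ 0` for `m ≠ 0`): with `Â = ampA p v`, `μ̂ = ampμ p v`, `φ = v∘inr∘inr`,
`f̂ = srcEL p r`, `γ = srcG p r`. -/
theorem fibreFun_eq_iff_enlArrow (v r : Idx D N → ℂ) :
    fibreFun (⇑(blochChar p)) v = r ↔
      ∃ c : ℂ, EnlArrow (goodFibre p hL') (zeroAlias (N := N) p)
        (fun m => srcEL p r m.1) (fun m => srcG p r m.1) (fun κ => srcEL p r (0 : TorusSite D N) κ) (srcG p r (0 : TorusSite D N))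
        (r (Sum.inr (Sum.inl 0))) (fun κ => r (Sum.inr (Sum.inr κ)))
        (fun m => ampA p v m.1) (fun m => ampμ p v m.1) (ampA p v (0 : TorusSite D N)) (ampμ p v (0 : TorusSite D N))
        (fun κ => v (Sum.inr (Sum.inr κ))) c := by
  rw [fibreFun_eq_iff_rows]
  rw [forall_congr' fun κ => EL_iff p v r κ, G_iff p v r, M_iff p v r, forall_congr' fun κ => Q_iff p v r κ]
  simp only [EnlArrow, ELRows, GRows, goodFibre, zeroAlias]
  have hM0 : (∑ m : TorusSite D N, boxS p m * ampμ p v m = r (Sum.inr (Sum.inl 0)))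
      ↔ boxS p (0 : TorusSite D N) * ampμ p v 0 + ∑ m : Good D N, boxS p m.1 * ampμ p v m.1 = r (Sum.inr (Sum.inl 0)) := by
    rw [sum_torus_eq]
  have hQ0 : ∀ κ, (∑ m : TorusSite D N, boxSs p m κ * ampA p v m κ = r (Sum.inr (Sum.inr κ)))
      ↔ boxSs p (0 : TorusSite D N) κ * ampA p v 0 κ + ∑ m : Good D N, boxSs p m.1 κ * ampA p v m.1 κ = r (Sum.inr (Sum.inr κ)) := by
    intro κ; rw [sum_torus_eq]
  constructor
  · rintro ⟨hEL, ⟨c, hG⟩, hM, hQ⟩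
    exact ⟨c, fun m κ => hEL κ m.1, fun m => hG m.1, fun κ => hEL κ 0, hG 0, hM0.mp hM, fun κ => (hQ0 κ).mp (hQ κ)⟩
  · rintro ⟨c, hEL, hG, hE0, hGz, hM, hQ⟩
    refine ⟨fun κ => forall_torus_iff.mpr ⟨hE0 κ, fun m => hEL m κ⟩, ⟨c, forall_torus_iff.mpr ⟨hGz, hG⟩⟩, hM0.mpr hM, fun κ => (hQ0 κ).mpr (hQ κ)⟩

/-- [folklore] **THE BLOCH FIBRE SYSTEM IS THE ENLARGED CAPACITANCE SYSTEM** (plus the explicit good amplitudes). -/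
theorem fibreFun_eq_iff_enlSolves (v r : Idx D N → ℂ) :
    fibreFun (⇑(blochChar p)) v = r ↔
      ∃ c : ℂ,
        (fun m : Good D N => ampA p v m.1)
            = Ablk (goodFibre p hL') (fun m => srcEL p r m.1) (fun m => srcG p r m.1) (fun κ => v (Sum.inr (Sum.inr κ))) c ∧
        (fun m : Good D N => ampμ p v m.1) = mublk (goodFibre p hL') (fun m => srcEL p r m.1) (fun κ => v (Sum.inr (Sum.inr κ))) ∧
        EnlSolves (goodFibre p hL') (zeroAlias (N := N) p)
          (fun m => srcEL p r m.1) (fun m => srcG p r m.1) (fun κ => srcEL p r (0 : TorusSite D N) κ) (srcG p r (0 : TorusSite D N))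
          (r (Sum.inr (Sum.inl 0))) (fun κ => r (Sum.inr (Sum.inr κ)))
          (ampA p v (0 : TorusSite D N)) (ampμ p v (0 : TorusSite D N)) (fun κ => v (Sum.inr (Sum.inr κ))) c := by
  rw [fibreFun_eq_iff_enlArrow p hL']
  exact exists_congr fun c => enlArrow_iff _ _ _ _ _ _ _ _ _ _ _ _ _ _

end Dictionary

/-! ## §4 The (U1) socket: injectivity of the homogeneous enlarged system ⇒ `det ≠ 0` -/

section Det

variable (p : Fin D → ℂ) (hL' : ∀ m : Good D N, lapSym (kFine p m.1) ≠ 0)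

/-- [folklore] Box data with zero amplitudes and zero multiplier slot vanish (leaf-16's inverse dictionary). -/
theorem eq_zero_of_amp_zero {v : Idx D N → ℂ} (hA : ∀ m κ, ampA p v m κ = 0) (hμ : ∀ m, ampμ p v m = 0)
    (hφ : ∀ κ, v (Sum.inr (Sum.inr κ)) = 0) : v = 0 := by
  funext i
  rcases i with ⟨κ, zz⟩ | (zz | κ)
  · rw [boxData_inl_eq_sum p v κ zz]
    exact Finset.sum_eq_zero fun m _ => by rw [hA m κ, zero_mul]
  · rw [boxData_inr_eq_sum p v zz]
    exact Finset.sum_eq_zero fun m _ => by rw [hμ m, zero_mul]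
  · exact hφ κ

/-- [folklore] **(U1) SOCKET.**  If the homogeneous enlarged capacitance system at `p` has only the trivial solution, the fibre map is injective. -/
theorem fibreFun_injective_of_enl_injective
    (hinj : ∀ (A0 : Fin D → ℂ) (μ0 : ℂ) (φ : Fin D → ℂ) (c : ℂ),
      EnlSolves (goodFibre p hL') (zeroAlias (N := N) p) 0 0 0 0 0 0 A0 μ0 φ c → A0 = 0 ∧ μ0 = 0 ∧ φ = 0 ∧ c = 0)
    {v : Idx D N → ℂ} (hv : fibreFun (⇑(blochChar p)) v = 0) : v = 0 := by
  obtain ⟨c, hA, hμ, hE⟩ := (fibreFun_eq_iff_enlSolves p hL' v 0).mp hv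
  have hs : (fun m : Good D N => srcEL p (0 : Idx D N → ℂ) m.1) = 0 := by
    funext m; rw [srcEL_zero]; rfl
  have hg : (fun m : Good D N => srcG p (0 : Idx D N → ℂ) m.1) = 0 := by
    funext m; rw [srcG_zero]; rfl
  have hs0 : (fun κ => srcEL p (0 : Idx D N → ℂ) (0 : TorusSite D N) κ) = 0 := by
    funext κ; rw [srcEL_zero]; rfl
  have hg0 : srcG p (0 : Idx D N → ℂ) (0 : TorusSite D N) = 0 := by rw [srcG_zero]; rfl
  rw [hs, hg, hs0, hg0] at hE
  have hq : (fun κ => (0 : Idx D N → ℂ) (Sum.inr (Sum.inr κ))) = (0 : Fin D → ℂ) := rfl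
  have hρ : (0 : Idx D N → ℂ) (Sum.inr (Sum.inl 0)) = 0 := rfl
  rw [hq, hρ] at hE
  obtain ⟨hA0, hμ0, hφ, hc⟩ := hinj _ _ _ _ hE
  rw [hs, hg, hφ, hc] at hA
  rw [hs, hφ] at hμ
  refine eq_zero_of_amp_zero p (fun m κ => ?_) (fun m => ?_) (fun κ => congrFun hφ κ)
  · by_cases hm : m = 0
    · subst hm; exact congrFun hA0 κ
    · have := congrFun hA ⟨m, hm⟩
      simp only at this
      rw [this, Ablk_zero]; rfl
  · by_cases hm : m = 0
    · subst hm; exact hμ0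
    · have := congrFun hμ ⟨m, hm⟩
      simp only at this
      rw [this, mublk_zero]

/-- [folklore] **(U1) FROM THE ENLARGED SYSTEM**: `det (fibreMatrix (blochChar p)) ≠ 0`. -/
theorem det_fibreMatrix_ne_zero_of_enl_injective
    (hinj : ∀ (A0 : Fin D → ℂ) (μ0 : ℂ) (φ : Fin D → ℂ) (c : ℂ),
      EnlSolves (goodFibre p hL') (zeroAlias (N := N) p) 0 0 0 0 0 0 A0 μ0 φ c → A0 = 0 ∧ μ0 = 0 ∧ φ = 0 ∧ c = 0) :
    (fibreMatrix (N := N) (⇑(blochChar p))).det ≠ 0 := by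
  refine det_ne_zero_of_mulVec_injective _ fun v w hvw => ?_
  have h : fibreFun (⇑(blochChar p)) (v - w) = 0 := by
    rw [← fibreLin_apply, map_sub, fibreLin_apply, fibreLin_apply, ← fibreMatrix_mulVec, ← fibreMatrix_mulVec, hvw, sub_self]
  exact sub_eq_zero.mp (fibreFun_injective_of_enl_injective p hL' hinj h)

/-- [folklore] The same in `trigPolySymbol (stencil (d+1)) pieceMatrix` currency (the `hdet` binder of `StripRegularPackaging`). -/
theorem det_trigPolySymbol_ne_zero_of_enl_injective {d : ℕ} (p : Fin (d + 1) → ℂ)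
    (hL' : ∀ m : Good (d + 1) N, lapSym (kFine p m.1) ≠ 0)
    (hinj : ∀ (A0 : Fin (d + 1) → ℂ) (μ0 : ℂ) (φ : Fin (d + 1) → ℂ) (c : ℂ),
      EnlSolves (goodFibre p hL') (zeroAlias (N := N) p) 0 0 0 0 0 0 A0 μ0 φ c → A0 = 0 ∧ μ0 = 0 ∧ φ = 0 ∧ c = 0) :
    (trigPolySymbol (stencil (d + 1)) (pieceMatrix (N := N)) p).det ≠ 0 := by
  rw [← fibreMatrix_blochChar_eq_trigPolySymbol]
  exact det_fibreMatrix_ne_zero_of_enl_injective p hL' hinj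

end Det

/-! ## §5 The (U2) socket: the solution read back on the box -/

section Readout

variable (p : Fin D → ℂ) (hL' : ∀ m : Good D N, lapSym (kFine p m.1) ≠ 0)

/-- [folklore] **BOX READOUT OF THE SOLUTION**: if `fibreFun (blochChar p) v = r` then, with `c` the gauge constant of `fibreFun_eq_iff_enlSolves` and
`(Â_0, μ̂_0, φ) = (ampA p v 0, ampμ p v 0, v∘inr∘inr)` solving the enlarged system, the field legs are the zero-alias wave plus the explicit good-alias synthesis:
`v (inl (κ,z)) = Â_0κ·pw k_0 (repZ z) + Σ_{m≠0} Ablk … m κ·pw k_m (repZ z)`, and likewise `v (inr (inl z))` with `μ̂_0`, `mublk`. -/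
theorem boxData_eq_of_fibreFun_eq {v r : Idx D N → ℂ} (hv : fibreFun (⇑(blochChar p)) v = r) :
    ∃ c : ℂ,
      EnlSolves (goodFibre p hL') (zeroAlias (N := N) p)
          (fun m => srcEL p r m.1) (fun m => srcG p r m.1) (fun κ => srcEL p r (0 : TorusSite D N) κ) (srcG p r (0 : TorusSite D N))
          (r (Sum.inr (Sum.inl 0))) (fun κ => r (Sum.inr (Sum.inr κ)))
          (ampA p v (0 : TorusSite D N)) (ampμ p v (0 : TorusSite D N)) (fun κ => v (Sum.inr (Sum.inr κ))) c ∧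
      (∀ κ (z : TorusSite D N), v (Sum.inl (κ, z))
          = ampA p v 0 κ * FibreSymbols.pw (kFine p (0 : TorusSite D N)) (repZ z)
            + ∑ m : Good D N, Ablk (goodFibre p hL') (fun m => srcEL p r m.1) (fun m => srcG p r m.1)
                (fun κ => v (Sum.inr (Sum.inr κ))) c m κ * FibreSymbols.pw (kFine p m.1) (repZ z)) ∧
      (∀ z : TorusSite D N, v (Sum.inr (Sum.inl z))
          = ampμ p v 0 * FibreSymbols.pw (kFine p (0 : TorusSite D N)) (repZ z)
            + ∑ m : Good D N, mublk (goodFibre p hL') (fun m => srcEL p r m.1)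
                (fun κ => v (Sum.inr (Sum.inr κ))) m * FibreSymbols.pw (kFine p m.1) (repZ z)) := by
  obtain ⟨c, hA, hμ, hE⟩ := (fibreFun_eq_iff_enlSolves p hL' v r).mp hv
  refine ⟨c, hE, fun κ z => ?_, fun z => ?_⟩
  · rw [boxData_inl_eq_sum p v κ z, sum_torus_eq]
    congr 1
    exact Finset.sum_congr rfl fun m _ => by rw [← hA]
  · rw [boxData_inr_eq_sum p v z, sum_torus_eq]
    congr 1
    exact Finset.sum_congr rfl fun m _ => by rw [← hμ]

end Readout

end Summit.QuantumFields.BalabanUV.Beta.GAN24.EnlargedCapacitance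

end
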